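import Literature.AlgebraicGeometry.Resolution.LUComplete3TrustBase
import Literature.AlgebraicGeometry.Resolution.ArithmeticalThreefoldsLocalTower
import Literature.AlgebraicGeometry.Resolution.ArithmeticalThreefoldsReduction
import HarnessLib

/-!
# The climbing statement of Cossart–Piltant 2019, Prop. 4.10, FROM Thm. 1.1 as printed

Topic: `Literature/AlgebraicGeometry/Resolution`. PROVED edges; nothing is vendored.

The proof side of `CossartPiltant2019ReductionP` (`ArithmeticalThreefoldsReduction.lean`,
`cossartPiltant2019ReductionP_of_climb`) reduces (LU) for complete local domains of dimension three
to the CLIMBING STATEMENT over the Cohen subring: for an excellent regular local `S` of dimension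
three, a field `E ⊇ S` algebraic over `S`, a valuation ring `O_E ∋ S` of `E` dominating `S` with
residue field algebraic over `S/𝔪_S`, and a finite `s₀ ⊆ E`, SOME finitely generated model
`S[t] ⊆ O_E` of the subfield `F(s₀)` (`F = Frac S`) is regular at the centre of `O_E`. The tree
climbs there from the local theorem (Thm. 1.5) through the ramification-theoretic tower, two of
whose rungs are the printed statements [CoP1] Lemma 9.4 (Kummer core) and Prop. 9.3 whose printed
proofs are incomplete (summit side: `@[conjecture]` defs).

This file proves the climbing statement — for EVERY excellent local domain `S` of dimension `≤ 3`,
with no completeness, regularity or characteristic hypothesis — from Cossart–Piltant's Thm. 1.1 AS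
PRINTED (`CossartPiltant2019General`): the local ring `T_P` of the model `T = S[s₀]` at the centre
of the valuation is a quasi-excellent local domain of dimension `≤ 3` (dimension inequality at a
residually algebraic centre, `ringKrullDim_localization_le_of_isAlgebraic`; excellence is stable
under essentially finite type, `isExcellentRing_localization_atPrime`), so Thm. 1.1 applied to
`Spec T_P` and read along the valuation (`CossartPiltant2019General.exists_fg_regular`) gives a
finitely generated `T_P[u] ⊆ O` regular at the centre, and `S[T ∪ u] ⊆ T_P[u] ⊆ S[T ∪ u]_𝔪`
(`isRegularLocalRing_localization_adjoin_union_iff`) turns it back into a model over `S`.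

* (private) `exists_finset_subset_valuationSubring_closure_eq` — generators of `F(s₀)` may be taken
  in `O_E` (replace `x ∉ O_E` by `x⁻¹`); (private) transport of a model along `K → E`;
* `CossartPiltant2019General.exists_adjoin_union_isRegularLocalRing` — the one-field form: a
  finitely generated model `T ⊆ O` of `K = Frac T` is refined to `S[T ∪ u] ⊆ O` regular at the
  centre;
* `CossartPiltant2019General.climb` — the climbing statement (shape of the hypothesis of
  `cossartPiltant2019ReductionP_of_climb`, its `CossartPiltant2019Local →` prefix dropped) for
  every excellent local domain `S` of dimension `≤ 3`.

Consequence recorded summit-side (crux `CleanModels`, stub 2): the two `@[conjecture]` push-down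
statements are COROLLARIES of Thm. 1.1 as printed. In the paper the logic runs the other way
(Thm. 1.1 is deduced from the climb), so this is a statement about trust bases, not a line of
proof of Thm. 1.1. AI-written; weaker than expert review.

## Sources

* V. Cossart, O. Piltant, J. Algebra 529 (2019) 268–535 = arXiv:1412.0868: Thm. 1.1, §4.1 (LU),
  proof of Prop. 4.10 (arXiv v1: Prop. 4.8, pp. 53–54). [CossartPiltant2019]
* H. Matsumura, *Commutative Ring Theory*, CUP 1986, Thm. 15.5. [Matsumura1987]
-/

noncomputable section

open IsLocalRing Polynomial

namespace Literature.AlgebraicGeometry.Resolution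

universe u

/-! ## Generators inside the valuation ring -/

/-- A finitely generated subfield `F(s₀)` of a valued field has finitely many generators INSIDE
the valuation ring: replace each generator outside `O` by its inverse. [folklore] -/
private theorem exists_finset_subset_valuationSubring_closure_eq {S E : Type u} [CommRing S] [Field E]
    [Algebra S E] (OE : ValuationSubring E) (s₀ : Finset E) :
    ∃ s₁ : Finset E, (↑s₁ : Set E) ⊆ OE ∧
      Subfield.closure (Set.range (algebraMap S E) ∪ (s₁ : Set E)) =
        Subfield.closure (Set.range (algebraMap S E) ∪ (s₀ : Set E)) := by
  classical
  refine ⟨s₀.image fun x => if x ∈ OE then x else x⁻¹, ?_, ?_⟩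
  · intro y hy
    rw [Finset.coe_image] at hy
    obtain ⟨x, hx, rfl⟩ := hy
    by_cases h : x ∈ OE
    · simp [h]
    · rcases OE.mem_or_inv_mem x with h' | h'
      · exact absurd h' h
      · simpa [h] using h'
  · apply le_antisymm
    · refine Subfield.closure_le.2 ?_
      rintro y (hy | hy)
      · exact Subfield.subset_closure (Or.inl hy)
      · rw [Finset.coe_image] at hy
        obtain ⟨x, hx, rfl⟩ := hy
        have hxc : x ∈ Subfield.closure (Set.range (algebraMap S E) ∪ (s₀ : Set E)) :=
          Subfield.subset_closure (Or.inr hx)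
        by_cases h : x ∈ OE
        · simpa [h] using hxc
        · simpa [h] using inv_mem hxc
    · refine Subfield.closure_le.2 ?_
      rintro y (hy | hy)
      · exact Subfield.subset_closure (Or.inl hy)
      · by_cases h : y ∈ OE
        · refine Subfield.subset_closure (Or.inr ?_)
          rw [Finset.coe_image]
          exact ⟨y, hy, by simp [h]⟩
        · have hmem : y⁻¹ ∈ Subfield.closure (Set.range (algebraMap S E) ∪
              ((s₀.image fun x => if x ∈ OE then x else x⁻¹ : Finset E) : Set E)) := by
            refine Subfield.subset_closure (Or.inr ?_)
            rw [Finset.coe_image]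
            exact ⟨y, hy, by simp [h]⟩
          simpa using inv_mem hmem

/-! ## One field: a finitely generated model is refined to a regular one (Thm. 1.1 along a valuation) -/

/-- **Thm. 1.1 over the local ring of a model.** Let `S` be an excellent local domain of dimension
`≤ 3` mapping to a field `K` algebraic over it, `O` a valuation ring of `K` containing `S`,
dominating it, with residue field algebraic over `S/𝔪_S`, and `T ⊆ O` a finitely generated
`S`-subalgebra with `Frac T = K`. Then for some finite `u ⊆ K` the model `S[T ∪ u] ⊆ O` is regular
at the centre of `O`. Proof: `T_P` (`P` the centre) is quasi-excellent of dimension `≤ 3`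
(Matsumura Thm. 15.5 at a residually algebraic centre), Thm. 1.1 along the valuation
(`CossartPiltant2019General.exists_fg_regular`) gives `T_P[u] ⊆ O` regular at the centre, and
`S[T ∪ u]` has the same local ring there. [cite: CossartPiltant2019, Thm. 1.1 with §4.1 (LU)]
[cite: Matsumura1987, Thm. 15.5] -/
theorem CossartPiltant2019General.exists_adjoin_union_isRegularLocalRing
    (hG : CossartPiltant2019General.{u})
    {S K : Type u} [CommRing S] [IsDomain S] [IsLocalRing S] [Field K] [Algebra S K]
    [Algebra.IsAlgebraic S K] (hinj : Function.Injective (algebraMap S K))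
    (hS : IsExcellentRing S) (hSdim : ringKrullDim S ≤ 3)
    (O : ValuationSubring K) (hSO : ∀ s : S, algebraMap S K s ∈ O)
    (hdom : ∀ s ∈ maximalIdeal S, O.valuation (algebraMap S K s) < 1)
    (hres : ∀ y : O, ∃ q : S[X], (∃ i, q.coeff i ∉ maximalIdeal S) ∧
      O.valuation (q.eval₂ (algebraMap S K) y) < 1)
    (T : Subalgebra S K) (hTfg : T.FG) (hTO : ∀ z : T, (z : K) ∈ O)
    (hfrac : IsFractionRing T K) :
    ∃ (u : Finset K) (hu : (Algebra.adjoin S ((T : Set K) ∪ (u : Set K))).toSubring ≤ O.toSubring),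
      IsRegularLocalRing (Localization.AtPrime
        (Ideal.comap (Subring.inclusion hu) (maximalIdeal O))) := by
  classical
  haveI hfrac' := hfrac
  haveI : IsNoetherianRing S := hS.isUniversallyCatenaryRing.1
  -- the centre `P` of `O` on `T`
  have hTO' : T.toSubring ≤ O.toSubring := fun x hx => hTO ⟨x, hx⟩
  set P : Ideal T := Ideal.comap (Subring.inclusion hTO') (maximalIdeal O) with hPdef
  haveI : P.IsPrime := Ideal.IsPrime.comap _
  have hP : ∀ z : T, z ∈ P ↔ O.valuation (z : K) < 1 := fun z => by
    rw [hPdef, Ideal.mem_comap, ValuationSubring.valuation_lt_one_iff]; rfl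
  -- the local ring `T_P`, realised in `K`
  let Sₚ := Localization.AtPrime P
  haveI : IsDomain Sₚ := IsLocalization.isDomain_localization P.primeCompl_le_nonZeroDivisors
  have hunits : ∀ y : P.primeCompl, IsUnit (algebraMap T K y) := fun y => by
    rw [isUnit_iff_ne_zero]
    intro h0
    apply y.2
    have : (y : T) = 0 := Subtype.ext h0
    rw [this]
    exact P.zero_mem
  letI : Algebra Sₚ K := (IsLocalization.lift (M := P.primeCompl) hunits).toAlgebra
  haveI : IsScalarTower T Sₚ K :=
    IsScalarTower.of_algebraMap_eq fun a => (IsLocalization.lift_eq hunits a).symm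
  haveI : IsFractionRing Sₚ K :=
    IsFractionRing.isFractionRing_of_isDomain_of_isLocalization P.primeCompl Sₚ K
  have hSSp : ∀ s : S, algebraMap S Sₚ s = algebraMap T Sₚ (algebraMap S T s) :=
    fun s => IsScalarTower.algebraMap_apply S T Sₚ s
  haveI : IsScalarTower S Sₚ K := IsScalarTower.of_algebraMap_eq fun s => by
    rw [hSSp, ← IsScalarTower.algebraMap_apply T Sₚ K, ← IsScalarTower.algebraMap_apply S T K]
  -- `T_P` is quasi-excellent of dimension `≤ 3`
  haveI : Algebra.FiniteType S T := (Subalgebra.fg_iff_finiteType _).mp hTfg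
  have hexc : IsExcellentRing Sₚ := isExcellentRing_localization_atPrime hS P
  haveI : FaithfulSMul S T := (faithfulSMul_iff_algebraMap_injective _ _).mpr fun a b hab =>
    hinj (by
      have h1 := congrArg (fun z : T => (z : K)) hab
      rw [IsScalarTower.algebraMap_apply S T K a, IsScalarTower.algebraMap_apply S T K b]
      exact h1)
  haveI : Algebra.IsAlgebraic S T :=
    Algebra.IsAlgebraic.of_injective T.val Subtype.val_injective
  haveI := liesOver_maximalIdeal_of_forall_valuation_lt_one O hSO hdom T P hP
  haveI := isAlgebraic_quotient_of_forall_valuation_lt_one O hres T hTO P hP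
  have hdimSp : ringKrullDim Sₚ ≤ 3 := (ringKrullDim_localization_le_of_isAlgebraic P).trans hSdim
  -- `T_P ⊆ O`
  have hSpO : ∀ a : Sₚ, algebraMap Sₚ K a ∈ O := by
    intro a
    obtain ⟨⟨x, y⟩, rfl⟩ := IsLocalization.mk'_surjective P.primeCompl a
    have hy1 : O.valuation ((y : T) : K) = 1 := by
      have hle : O.valuation ((y : T) : K) ≤ 1 := (O.valuation_le_one_iff _).mpr (hTO _)
      have hnlt : ¬ O.valuation ((y : T) : K) < 1 := fun hlt => y.2 ((hP _).mpr hlt)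
      exact le_antisymm hle (not_lt.mp hnlt)
    have hy0 : ((y : T) : K) ≠ 0 := fun h0 => by rw [h0, map_zero] at hy1; exact zero_ne_one hy1
    have h1 := IsLocalization.mk'_spec Sₚ x y
    have h2 := congrArg (algebraMap Sₚ K) h1
    rw [map_mul, ← IsScalarTower.algebraMap_apply, ← IsScalarTower.algebraMap_apply] at h2
    have h3 : algebraMap Sₚ K (IsLocalization.mk' Sₚ x y) * ((y : T) : K) = (x : K) := h2
    have h4 : algebraMap Sₚ K (IsLocalization.mk' Sₚ x y) = (x : K) * (((y : T) : K))⁻¹ := by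
      rw [← h3, mul_inv_cancel_right₀ hy0]
    rw [h4]
    refine mul_mem (hTO x) ?_
    rw [← O.valuation_le_one_iff, map_inv₀, hy1, inv_one]
  -- Thm. 1.1 along the valuation, over `T_P`
  obtain ⟨U, hU, hUfg, hregU⟩ :=
    hG.exists_fg_regular Stacks07QU_holds hexc.isQuasiExcellentRing hdimSp O hSpO
  obtain ⟨u, rfl⟩ := hUfg
  -- back to a model over `S`
  set Q : Ideal (Algebra.adjoin Sₚ (u : Set K)) :=
    Ideal.comap (Subring.inclusion hU) (maximalIdeal O) with hQdef
  haveI : Q.IsPrime := Ideal.IsPrime.comap _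
  have hQ : ∀ y : Algebra.adjoin Sₚ (u : Set K), y ∈ Q ↔ O.valuation (y : K) < 1 := fun y => by
    rw [hQdef, Ideal.mem_comap, ValuationSubring.valuation_lt_one_iff]; rfl
  let A : Subalgebra S K := Algebra.adjoin S ((T : Set K) ∪ (u : Set K))
  have hAU : ∀ y : A, (y : K) ∈ Algebra.adjoin Sₚ (u : Set K) := fun y =>
    mem_adjoin_localization_of_mem_adjoin_union T Sₚ (u : Set K) y.2
  have hAO : A.toSubring ≤ O.toSubring := fun y hy => hU (hAU ⟨y, hy⟩)
  refine ⟨u, hAO, ?_⟩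
  set P' : Ideal A := Ideal.comap (Subring.inclusion hAO) (maximalIdeal O) with hP'def
  haveI : P'.IsPrime := Ideal.IsPrime.comap _
  have hP' : ∀ y : A, y ∈ P' ↔ O.valuation (y : K) < 1 := fun y => by
    rw [hP'def, Ideal.mem_comap, ValuationSubring.valuation_lt_one_iff]; rfl
  exact (isRegularLocalRing_localization_adjoin_union_iff O T P Sₚ hP (u : Set K) P' hP' Q
    hQ).mpr hregU

/-! ## Transport of a model along a field embedding `K → E` -/

/-- **A model over `S` in `K ⊆ E`, regular at the centre of `O_E ∩ K`, is a model in `E` regular at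
the centre of `O_E`**, under any description `S[t]` of its image (`isRegularLocalRing_localization_map_iff`
and `isRegularLocalRing_localization_iff_of_subalgebra_eq`, packaged with the valuation ring of `K`
given as the restriction `O_E ∩ K`). [folklore] -/
private theorem exists_isRegularLocalRing_localization_adjoin_of_map_eq
    {S K E : Type u} [CommRing S] [Field K] [Field E] [Algebra S K] [Algebra S E] [Algebra K E]
    [IsScalarTower S K E] (OE : ValuationSubring E) (R : Subalgebra S K)
    (hRO : R.toSubring ≤ (OE.comap (algebraMap K E)).toSubring)
    (hreg : IsRegularLocalRing (Localization.AtPrime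
      (Ideal.comap (Subring.inclusion hRO) (maximalIdeal (OE.comap (algebraMap K E))))))
    (t : Set E) (hEq : R.map (IsScalarTower.toAlgHom S K E) = Algebra.adjoin S t) :
    ∃ hTO : (Algebra.adjoin S t).toSubring ≤ OE.toSubring,
      IsRegularLocalRing (Localization.AtPrime
        (Ideal.comap (Subring.inclusion hTO) (maximalIdeal OE))) := by
  have hOK : ∀ z : K, OE.valuation (algebraMap K E z) < 1 ↔
      (OE.comap (algebraMap K E)).valuation z < 1 := fun z =>
    valuation_algebraMap_lt_one_iff_of_comap_eq' (OE.comap (algebraMap K E)) OE rfl z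
  haveI : (Ideal.comap (Subring.inclusion hRO) (maximalIdeal (OE.comap (algebraMap K E)))).IsPrime :=
    Ideal.IsPrime.comap _
  have hP : ∀ y : R, y ∈ Ideal.comap (Subring.inclusion hRO) (maximalIdeal (OE.comap (algebraMap K E)))
      ↔ OE.valuation (IsScalarTower.toAlgHom S K E y) < 1 := fun y => by
    rw [Ideal.mem_comap, ValuationSubring.valuation_lt_one_iff, IsScalarTower.coe_toAlgHom', hOK]
    rfl
  have hRO' : (R.map (IsScalarTower.toAlgHom S K E)).toSubring ≤ OE.toSubring := by
    intro x hx
    obtain ⟨y, hy, rfl⟩ := Subalgebra.mem_map.mp hx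
    exact ValuationSubring.mem_comap.mp (hRO hy)
  haveI : (Ideal.comap (Subring.inclusion hRO') (maximalIdeal OE)).IsPrime := Ideal.IsPrime.comap _
  have hQ : ∀ y : R.map (IsScalarTower.toAlgHom S K E),
      y ∈ Ideal.comap (Subring.inclusion hRO') (maximalIdeal OE) ↔ OE.valuation (y : E) < 1 :=
    fun y => by rw [Ideal.mem_comap, ValuationSubring.valuation_lt_one_iff]; rfl
  have hregQ : IsRegularLocalRing (Localization.AtPrime
      (Ideal.comap (Subring.inclusion hRO') (maximalIdeal OE))) :=
    (isRegularLocalRing_localization_map_iff (IsScalarTower.toAlgHom S K E) OE R _ hP _ hQ).mp hreg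
  have hTO : (Algebra.adjoin S t).toSubring ≤ OE.toSubring := hEq ▸ hRO'
  haveI : (Ideal.comap (Subring.inclusion hTO) (maximalIdeal OE)).IsPrime := Ideal.IsPrime.comap _
  have hQ₂ : ∀ y : Algebra.adjoin S t,
      y ∈ Ideal.comap (Subring.inclusion hTO) (maximalIdeal OE) ↔ OE.valuation (y : E) < 1 :=
    fun y => by rw [Ideal.mem_comap, ValuationSubring.valuation_lt_one_iff]; rfl
  exact ⟨hTO, (isRegularLocalRing_localization_iff_of_subalgebra_eq OE hEq _ hQ _ hQ₂).mp hregQ⟩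

/-! ## The climbing statement over any field algebraic over `S`, from Thm. 1.1 -/

/-- **The climbing statement of Cossart–Piltant's Prop. 4.10 from Thm. 1.1 as printed.** For an
excellent local domain `S` of dimension `≤ 3`, a field `E ⊇ S` algebraic over `S`, a valuation
ring `O_E ∋ S` of `E` dominating `S` with residue field algebraic over `S/𝔪_S`, and a finite
`s₀ ⊆ E`: some finite `t ⊆ F(s₀)` with `s₀ ⊆ F(t)` (`F = Frac S`) has `S[t] ⊆ O_E` regular at the
centre of `O_E` — the hypothesis of `cossartPiltant2019ReductionP_of_climb` (there: `S` complete
regular of dimension three and residue characteristic `p`, `E` algebraically closed), here from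
`CossartPiltant2019General`: move the generators into `O_E`, pass to the fraction field
`K = Frac S[s₁]` with the restricted valuation, refine the model by
`CossartPiltant2019General.exists_adjoin_union_isRegularLocalRing`, and transport the model back
along `K → E` (`isRegularLocalRing_localization_map_iff`).
[cite: CossartPiltant2019, Thm. 1.1 with §4.1 (LU); proof of Prop. 4.10 (arXiv v1: Prop. 4.8)] -/
theorem CossartPiltant2019General.climb (hG : CossartPiltant2019General.{u})
    {S : Type u} [CommRing S] [IsDomain S] [IsLocalRing S] (hS : IsExcellentRing S)
    (hSdim : ringKrullDim S ≤ 3)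
    {E : Type u} [Field E] [Algebra S E] (hinj : Function.Injective (algebraMap S E))
    [Algebra.IsAlgebraic S E]
    (OE : ValuationSubring E) (hSO : ∀ s : S, algebraMap S E s ∈ OE)
    (hdom : ∀ s ∈ maximalIdeal S, OE.valuation (algebraMap S E s) < 1)
    (hres : ∀ y : OE, ∃ q : S[X], (∃ i, q.coeff i ∉ maximalIdeal S) ∧
      OE.valuation (q.eval₂ (algebraMap S E) y) < 1)
    (s₀ : Finset E) :
    ∃ t : Finset E,
      (t : Set E) ⊆ Subfield.closure (Set.range (algebraMap S E) ∪ (s₀ : Set E)) ∧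
      (s₀ : Set E) ⊆ Subfield.closure (Set.range (algebraMap S E) ∪ (t : Set E)) ∧
      ∃ hTO : (Algebra.adjoin S (t : Set E)).toSubring ≤ OE.toSubring,
        IsRegularLocalRing (Localization.AtPrime
          (Ideal.comap (Subring.inclusion hTO) (maximalIdeal OE))) := by
  classical
  -- Step 0: generators inside `O_E`
  obtain ⟨s₁, hs₁O, hcl⟩ := exists_finset_subset_valuationSubring_closure_eq (S := S) OE s₀
  suffices H : ∃ t : Finset E,
      (t : Set E) ⊆ Subfield.closure (Set.range (algebraMap S E) ∪ (s₁ : Set E)) ∧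
      (s₁ : Set E) ⊆ Subfield.closure (Set.range (algebraMap S E) ∪ (t : Set E)) ∧
      ∃ hTO : (Algebra.adjoin S (t : Set E)).toSubring ≤ OE.toSubring,
        IsRegularLocalRing (Localization.AtPrime
          (Ideal.comap (Subring.inclusion hTO) (maximalIdeal OE))) by
    obtain ⟨t, ht₁, ht₂, hTO, hreg⟩ := H
    refine ⟨t, hcl ▸ ht₁, ?_, hTO, hreg⟩
    have hle : Subfield.closure (Set.range (algebraMap S E) ∪ (s₀ : Set E)) ≤
        Subfield.closure (Set.range (algebraMap S E) ∪ (t : Set E)) := by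
      rw [← hcl]
      exact Subfield.closure_le.2
        (Set.union_subset (fun x hx => Subfield.subset_closure (Or.inl hx)) ht₂)
    exact fun x hx => hle (Subfield.subset_closure (Or.inr hx))
  -- Step 1: the model `T₀ = S[s₁] ⊆ O_E`, inside `F(s₁)`
  set T₀ : Subalgebra S E := Algebra.adjoin S (s₁ : Set E) with hT₀def
  have hT₀cl : ∀ a : T₀, (a : E) ∈ Subfield.closure (Set.range (algebraMap S E) ∪ (s₁ : Set E)) := by
    intro a
    refine Algebra.adjoin_induction (p := fun y _ => y ∈
        Subfield.closure (Set.range (algebraMap S E) ∪ (s₁ : Set E))) ?_ ?_ ?_ ?_ a.2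
    · exact fun y hy => Subfield.subset_closure (Or.inr hy)
    · exact fun s => Subfield.subset_closure (Or.inl ⟨s, rfl⟩)
    · exact fun _ _ _ _ hx hy => add_mem hx hy
    · exact fun _ _ _ _ hx hy => mul_mem hx hy
  have hT₀O : ∀ a : T₀, (a : E) ∈ OE := by
    intro a
    refine Algebra.adjoin_induction (p := fun y _ => y ∈ OE) ?_ ?_ ?_ ?_ a.2
    · exact fun y hy => hs₁O hy
    · exact fun s => hSO s
    · exact fun _ _ _ _ hx hy => add_mem hx hy
    · exact fun _ _ _ _ hx hy => mul_mem hx hy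
  -- Step 2: its fraction field `K` and the embedding `K → E`
  let K := FractionRing T₀
  have hval : Function.Injective (algebraMap T₀ E) := Subtype.val_injective
  let φ₀ : K →+* E := IsFractionRing.lift hval
  have hφ₀ : ∀ a : T₀, φ₀ (algebraMap T₀ K a) = (a : E) := fun a =>
    IsFractionRing.lift_algebraMap hval a
  letI : Algebra K E := φ₀.toAlgebra
  have hKE : ∀ z : K, algebraMap K E z = φ₀ z := fun _ => rfl
  haveI : IsScalarTower T₀ K E := IsScalarTower.of_algebraMap_eq fun a => by
    rw [hKE, hφ₀]; rfl
  haveI : IsScalarTower S K E := IsScalarTower.of_algebraMap_eq fun s => by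
    rw [IsScalarTower.algebraMap_apply S T₀ K, hKE, hφ₀]
    rfl
  have hinjK : Function.Injective (algebraMap S K) := by
    intro a b hab
    apply hinj
    have := congrArg (algebraMap K E) hab
    rwa [← IsScalarTower.algebraMap_apply, ← IsScalarTower.algebraMap_apply] at this
  let φ : K →ₐ[S] E := IsScalarTower.toAlgHom S K E
  have hφ : ∀ z : K, φ z = algebraMap K E z := fun _ => rfl
  haveI : Algebra.IsAlgebraic S K :=
    Algebra.IsAlgebraic.of_injective φ (algebraMap K E).injective
  -- every element of `K` lands in `F(s₁)`
  have hKcl : ∀ z : K, algebraMap K E z ∈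
      Subfield.closure (Set.range (algebraMap S E) ∪ (s₁ : Set E)) := by
    intro z
    obtain ⟨a, b, -, rfl⟩ := IsFractionRing.div_surjective (A := T₀) z
    rw [map_div₀, ← IsScalarTower.algebraMap_apply, ← IsScalarTower.algebraMap_apply]
    exact div_mem (hT₀cl a) (hT₀cl b)
  -- Step 3: the valuation restricted to `K`
  let OK : ValuationSubring K := OE.comap (algebraMap K E)
  have hOK : ∀ z : K, OE.valuation (algebraMap K E z) < 1 ↔ OK.valuation z < 1 := fun z =>
    valuation_algebraMap_lt_one_iff_of_comap_eq' OK OE rfl z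
  have hSOK : ∀ s : S, algebraMap S K s ∈ OK := fun s => by
    change algebraMap K E (algebraMap S K s) ∈ OE
    rw [← IsScalarTower.algebraMap_apply]
    exact hSO s
  have hdomK : ∀ s ∈ maximalIdeal S, OK.valuation (algebraMap S K s) < 1 := fun s hs => by
    rw [← hOK, ← IsScalarTower.algebraMap_apply]
    exact hdom s hs
  have hresK : ∀ y : OK, ∃ q : S[X], (∃ i, q.coeff i ∉ maximalIdeal S) ∧
      OK.valuation (q.eval₂ (algebraMap S K) y) < 1 := fun y => by
    obtain ⟨q, hq, hv⟩ := hres ⟨algebraMap K E y, y.2⟩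
    refine ⟨q, hq, ?_⟩
    rw [← hOK, Polynomial.hom_eval₂, ← IsScalarTower.algebraMap_eq]
    exact hv
  -- Step 4: the model `T₀` seen in `K`
  let ψ : T₀ →ₐ[S] K := IsScalarTower.toAlgHom S T₀ K
  have hψ : ∀ a : T₀, ψ a = algebraMap T₀ K a := fun _ => rfl
  set T : Subalgebra S K := ψ.range with hTdef
  have hTfg : T.FG := by
    haveI : Algebra.FiniteType S T₀ :=
      (Subalgebra.fg_iff_finiteType _).mp (Subalgebra.fg_adjoin_finset _)
    have h1 : (⊤ : Subalgebra S T₀).FG := Algebra.FiniteType.out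
    have h2 := h1.map ψ
    rwa [Algebra.map_top] at h2
  have hTO_K : ∀ z : T, (z : K) ∈ OK := by
    rintro ⟨_, a, rfl⟩
    change algebraMap K E (ψ a) ∈ OE
    rw [hψ, ← IsScalarTower.algebraMap_apply]
    exact hT₀O a
  haveI : FaithfulSMul T K := (faithfulSMul_iff_algebraMap_injective T K).mpr Subtype.val_injective
  have hfracT : IsFractionRing T K := by
    refine IsFractionRing.of_field T K fun z => ?_
    obtain ⟨a, b, -, hab⟩ := IsFractionRing.div_surjective (A := T₀) z
    exact ⟨⟨ψ a, a, rfl⟩, ⟨ψ b, b, rfl⟩, hab.symm⟩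
  -- Step 5: Thm. 1.1 over the local ring of the model, in `K`
  obtain ⟨u, hu, hregu⟩ := hG.exists_adjoin_union_isRegularLocalRing hinjK hS hSdim OK hSOK
    hdomK hresK T hTfg hTO_K hfracT
  -- Step 6: the image of the refined model in `E` is `S[t]`, `t = s₁ ∪ φ(u)`
  have hT_img : (φ : K → E) '' (T : Set K) = (T₀ : Set E) := by
    ext x
    constructor
    · rintro ⟨y, hy, rfl⟩
      obtain ⟨a, rfl⟩ := (AlgHom.mem_range ψ).mp hy
      rw [hφ, hψ, ← IsScalarTower.algebraMap_apply]
      exact a.2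
    · intro hx
      refine ⟨ψ ⟨x, hx⟩, (AlgHom.mem_range ψ).mpr ⟨⟨x, hx⟩, rfl⟩, ?_⟩
      rw [hφ, hψ, ← IsScalarTower.algebraMap_apply]
      rfl
  have hφ' : (φ : K → E) = (algebraMap K E : K → E) := rfl
  have hEq : (Algebra.adjoin S ((T : Set K) ∪ (u : Set K))).map φ =
      Algebra.adjoin S ((s₁ ∪ u.image (algebraMap K E) : Finset E) : Set E) := by
    rw [AlgHom.map_adjoin, Set.image_union, hT_img, Finset.coe_union, Finset.coe_image, hφ']
    change Algebra.adjoin S (((Algebra.adjoin S (s₁ : Set E) : Subalgebra S E) : Set E) ∪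
      (algebraMap K E : K → E) '' (u : Set K)) = _
    rw [Algebra.adjoin_union, Algebra.adjoin_eq, ← Algebra.adjoin_union]
  -- Step 7: transport along `K → E`
  obtain ⟨hTO, hreg⟩ :=
    exists_isRegularLocalRing_localization_adjoin_of_map_eq OE _ hu hregu _ hEq
  refine ⟨s₁ ∪ u.image (algebraMap K E), ?_, ?_, hTO, hreg⟩
  · intro x hx
    rw [Finset.coe_union, Finset.coe_image] at hx
    rcases hx with hx | ⟨y, -, rfl⟩
    · exact Subfield.subset_closure (Or.inr hx)
    · exact hKcl y
  · intro x hx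
    refine Subfield.subset_closure (Or.inr ?_)
    rw [Finset.coe_union]
    exact Or.inl hx

/-! ## Appended: the named fact `CossartPiltant2019ReductionP` from Thm. 1.1 through the climb -/

/-- **`CossartPiltant2019ReductionP` from Thm. 1.1 as printed, THROUGH the climbing statement**
(`cossartPiltant2019ReductionP_of_climb` ∘ `CossartPiltant2019General.climb`; the local-theorem
hypothesis of the reduction is not used). In the paper the implication runs the other way, so this
is a statement about the trust base of the named fact, not a line of proof of Thm. 1.1.
[cite: CossartPiltant2019, Thm. 1.1; proof of Prop. 4.10 (arXiv v1: Prop. 4.8)] -/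
theorem CossartPiltant2019ReductionP.of_general_climb (hG : CossartPiltant2019General.{u}) :
    CossartPiltant2019ReductionP.{u} :=
  cossartPiltant2019ReductionP_of_climb fun _ _ _ _ _ _ _ hS hdim _ _ _ _ _ hinj _ halg OE hSO hdom hres s₀ =>
    haveI := halg
    hG.climb hS hdim.le hinj OE hSO hdom hres s₀

end Literature.AlgebraicGeometry.Resolution

end
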